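import Literature.AlgebraicGeometry.Motives.HodgeLieWeightOnePeirce
import HarnessLib

/-!
# Weight one: the Peirce-`2` space of a minimal raising tripotent is the line `ℂB`, and the Peirce-`0` space vanishes when
# `2 · rank B > dim V^{1,0}` (Moonen–Zarhin 1999 (2.3); Loos' Peirce decomposition in the raising space)

Family `hodge`, layer `Literature/AlgebraicGeometry/Motives`; THEOREMS ONLY (no definition, no named fact; D-0026).  Written for the
cell `pub-hodgeav-hg6` (LADDER-HodgeAV row 2, TABLE X row 1 `g6.I(1)`: brick N7 of the row-1 programme «`End⁰ = ℚ`, `g = 6` ⟹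
`Hg = Sp₁₂`», whose remaining crux after `HodgeLieWeightOneRankTwelveReduction` is a minimal raising tripotent of rank `r ∈ {2, 3, 4}`;
honest framing of that cell: HC / HC_AV / HC_CM NOT proved — unconditional Hodge–Lie linear algebra).  Sequel of
`HodgeLieWeightOneMinimalRaising` (N4) and `HodgeLieWeightOnePeirce` (N5); notation as there: `B ∈ 𝔊` raising, non-zero, of minimal
rank `r`, `C = B̄`, `B C B = t B`, `E = t⁻¹ B C`, `F = t⁻¹ C B`, Peirce components `x₂ = E x F`, `x₁ = E x + x F − 2 E x F`,
`x₀ = x − E x − x F + E x F` of a raising `x ∈ 𝔊`.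

* **`WeightOnePeirce.peirceTwo_eq_smul`** — `E x F ∈ ℂ B` for every raising `x ∈ 𝔊` (the Peirce-`2` space of a MINIMAL tripotent is
  a line): `E x F = A B` with `A = t⁻¹ E x C` preserving `range B`; for an eigenvalue `s` of `A|_{range B}` the raising element
  `E x F − s B = (A − s) B ∈ 𝔊` has rank `< r`, hence vanishes.  (In matrix terms: for Peirce-`1` elements `x, y` the bracket
  `{x, ȳ, B} = x ȳ B + B ȳ x` is a MULTIPLE of `B` — the source of the scalar constraints of the Levi-core analysis.)
* **`WeightOnePeirce.peirceZero_eq_zero`** — if `2 r > dim V^{1,0}` then `x₀ = 0` for every raising `x ∈ 𝔊` (`x₀ ∈ 𝔊` is raising with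
  values in `(1 − E) V^{1,0}`, of dimension `dim V^{1,0} − r < r`); **`…eq_smul_add_peirceOne`** — hence `x = s B + x₁`: for
  `2 r > dim V^{1,0}` the raising space is `ℂ B ⊕ (Peirce-1 space)` (the case `r = 4`, `dim V^{1,0} = 6` of the cell's crux).

## References

* [MoonenZarhin1999LowDim] B. Moonen, Yu. Zarhin, *Hodge classes on abelian varieties of low dimension*, Math. Ann. 315 (1999),
  §2 (2.3)–(2.5).
* [Deligne1982HodgeCycles] P. Deligne, *Hodge cycles on abelian varieties*, LNM 900 (1982), I §3 (proof of Prop. 3.4, 3.6).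
* O. Loos, *Bounded symmetric domains and Jordan pairs* (Irvine 1977), §3 (Peirce decomposition; terminology only, not a cite key).
* [GoodmanWallachGTM255] R. Goodman, N. R. Wallach, GTM 255 (2009), §2.1.2.
-/

noncomputable section

open scoped TensorProduct

namespace Literature.AlgebraicGeometry.Motives

namespace HodgeStructure

universe u

variable {V : Type u} [AddCommGroup V] [Module ℚ V] [Module.Finite ℚ V] [HodgeTensorFacts.{u, u}] {n : ℤ}

set_option maxHeartbeats 1600000 in
/-- **The Peirce-`2` space of a minimal raising tripotent is the line `ℂB`**: for every raising `x ∈ 𝔊`,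
`(t⁻¹ B C) x (t⁻¹ C B) = s B` for some `s ∈ ℂ`. [cite: MoonenZarhin1999LowDim, §2 (2.3)–(2.5)]
[cite: Deligne1982HodgeCycles, I §3 (proof of Prop. 3.4, 3.6)] [cite: GoodmanWallachGTM255, §2.1.2] -/
theorem WeightOnePeirce.peirceTwo_eq_smul (H : HodgeStructure V n) (ψ : H.Polarization) (hn : n = 1)
    (heff : H.IsEffective) {Θ : Module.End ℂ (ℂ ⊗[ℚ] V)} (hΘ : ∀ p, ∀ x ∈ H.piece p (n - p), Θ x = ((2 * p - n : ℤ) : ℂ) • x)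
    {𝔊 : Submodule ℂ (Module.End ℂ (ℂ ⊗[ℚ] V))} (h𝔊 : 𝔊 ≤ H.hodgeLieC) (hbr : ∀ Y ∈ 𝔊, ∀ Z ∈ 𝔊, Y * Z - Z * Y ∈ 𝔊)
    {B C : Module.End ℂ (ℂ ⊗[ℚ] V)} (hB : B ∈ 𝔊) (hB0 : B ≠ 0) (hBP : ∀ p ∈ H.piece 1 0, B p = 0)
    (hBim : ∀ v, B v ∈ H.piece 1 0) (hC : ∀ v, C v = conj (B (conj v))) (hC𝔊 : C ∈ 𝔊)
    (hmin : ∀ B' ∈ 𝔊, B' ≠ 0 → (∀ p ∈ H.piece 1 0, B' p = 0) → (∀ v, B' v ∈ H.piece 1 0) →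
      Module.finrank ℂ (LinearMap.range B) ≤ Module.finrank ℂ (LinearMap.range B'))
    {t : ℂ} (ht : t ≠ 0) (hBCB : B * C * B = t • B)
    {x : Module.End ℂ (ℂ ⊗[ℚ] V)} (hx : x ∈ 𝔊) (hxP : ∀ p ∈ H.piece 1 0, x p = 0) (hxim : ∀ v, x v ∈ H.piece 1 0) :
    ∃ s : ℂ, t⁻¹ • (B * C) * x * (t⁻¹ • (C * B)) = s • B := by
  classical
  obtain ⟨hCBC, -⟩ := WeightOnePeirce.conjOp_mul_conjOp_mul hC ht hB0 hBCB
  subst hn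
  obtain ⟨hCQ, hCim, -, -⟩ := SymplecticThetaTen.conjOp_raise (P := H.piece 1 0) (Q := H.piece 0 1)
    (fun x hx => conj_mem_piece H hx) (fun x hx => conj_mem_piece H hx) hBP hBim hC
  have hBB : B * B = 0 := LinearMap.ext fun v => by
    rw [Module.End.mul_apply, hBP _ (hBim v), LinearMap.zero_apply]
  have hCC : C * C = 0 := LinearMap.ext fun v => by
    rw [Module.End.mul_apply, hCQ _ (hCim v), LinearMap.zero_apply]
  obtain ⟨E, hE⟩ : ∃ E : Module.End ℂ (ℂ ⊗[ℚ] V), E = t⁻¹ • (B * C) := ⟨_, rfl⟩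
  obtain ⟨F, hF⟩ : ∃ F : Module.End ℂ (ℂ ⊗[ℚ] V), F = t⁻¹ • (C * B) := ⟨_, rfl⟩
  rw [← hE, ← hF]
  have hEP : ∀ v, E v ∈ H.piece 1 0 := fun v => by
    rw [hE, LinearMap.smul_apply, Module.End.mul_apply]
    exact Submodule.smul_mem _ _ (hBim _)
  have hFP : ∀ p ∈ H.piece 1 0, F p = 0 := fun p hp => by
    rw [hF, LinearMap.smul_apply, Module.End.mul_apply, hBP p hp, map_zero, smul_zero]
  have hxB : x * B = 0 := LinearMap.ext fun v => by
    rw [Module.End.mul_apply, hxP _ (hBim v), LinearMap.zero_apply]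
  have hBx : B * x = 0 := LinearMap.ext fun v => by
    rw [Module.End.mul_apply, hBP _ (hxim v), LinearMap.zero_apply]
  obtain ⟨hExF, -⟩ := WeightOnePeirce.peirceOne_mem hbr ht hBCB hCBC hBB hCC hE hF hB hC𝔊 hx hxB hBx
  -- `E x F = A B` with `A = t⁻¹ E x C` preserving `range B`
  obtain ⟨A, hA⟩ : ∃ A : Module.End ℂ (ℂ ⊗[ℚ] V), A = t⁻¹ • (E * x * C) := ⟨_, rfl⟩
  have hAB : E * x * F = A * B := by rw [hA, hF, mul_smul_comm, smul_mul_assoc, ← mul_assoc]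
  have hAU : ∀ u ∈ LinearMap.range B, A u ∈ LinearMap.range B := fun u _ => by
    rw [hA, LinearMap.smul_apply, Module.End.mul_apply, Module.End.mul_apply, hE, LinearMap.smul_apply,
      Module.End.mul_apply]
    exact Submodule.smul_mem _ _ (Submodule.smul_mem _ _ (LinearMap.mem_range_self B _))
  haveI : Nontrivial (LinearMap.range B) := by
    rw [Submodule.nontrivial_iff_ne_bot]
    intro h
    exact hB0 (LinearMap.range_eq_bot.1 h)
  obtain ⟨s, hs⟩ := Module.End.exists_eigenvalue (A.restrict hAU)
  obtain ⟨u₀, hu₀⟩ := hs.exists_hasEigenvector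
  have hu₀eq : A (u₀ : ℂ ⊗[ℚ] V) = s • (u₀ : ℂ ⊗[ℚ] V) := by
    have h := congrArg Subtype.val hu₀.apply_eq_smul
    simpa only [LinearMap.coe_restrict_apply, Submodule.coe_smul] using h
  have hu₀ne : (u₀ : ℂ ⊗[ℚ] V) ≠ 0 := fun h => hu₀.2 (Subtype.ext h)
  obtain ⟨v₀, hv₀⟩ : ∃ v₀, B v₀ = u₀ := LinearMap.mem_range.1 u₀.2
  -- `y = E x F − s B` is raising, in `𝔊`, of smaller rank, hence `0`
  obtain ⟨y, hy⟩ : ∃ y : Module.End ℂ (ℂ ⊗[ℚ] V), y = E * x * F - s • B := ⟨_, rfl⟩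
  have hy𝔊 : y ∈ 𝔊 := hy ▸ Submodule.sub_mem _ hExF (Submodule.smul_mem _ _ hB)
  have hyP : ∀ p ∈ H.piece 1 0, y p = 0 := fun p hp => by
    rw [hy, LinearMap.sub_apply, Module.End.mul_apply, Module.End.mul_apply, LinearMap.smul_apply, hFP p hp, hBP p hp,
      map_zero, map_zero, smul_zero, sub_zero]
  have hyim : ∀ v, y v ∈ H.piece 1 0 := fun v => by
    rw [hy, LinearMap.sub_apply, Module.End.mul_apply, Module.End.mul_apply, LinearMap.smul_apply]
    exact Submodule.sub_mem _ (hEP _) (Submodule.smul_mem _ _ (hBim _))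
  have hyv : ∀ v, y v = A (B v) - s • B v := fun v => by
    rw [hy, LinearMap.sub_apply, hAB, Module.End.mul_apply, LinearMap.smul_apply]
  have hker : LinearMap.ker B ≤ LinearMap.ker y := fun v hv => by
    rw [LinearMap.mem_ker] at hv ⊢
    rw [hyv, hv, map_zero, smul_zero, sub_zero]
  have hv₀ker : v₀ ∈ LinearMap.ker y := by
    rw [LinearMap.mem_ker, hyv, hv₀, hu₀eq, sub_self]
  have hv₀nker : v₀ ∉ LinearMap.ker B := fun h => hu₀ne (by rw [← hv₀]; exact h)
  have hlt : Module.finrank ℂ (LinearMap.ker B) < Module.finrank ℂ (LinearMap.ker y) :=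
    Submodule.finrank_lt_finrank_of_lt (lt_of_le_of_ne hker fun h => hv₀nker (h ▸ hv₀ker))
  have hrk := LinearMap.finrank_range_add_finrank_ker B
  have hrk' := LinearMap.finrank_range_add_finrank_ker y
  have hy0 : y = 0 := by
    by_contra hne
    have h := hmin y hy𝔊 hne hyP hyim
    omega
  refine ⟨s, sub_eq_zero.1 ?_⟩
  rw [← hy]
  exact hy0

set_option maxHeartbeats 1600000 in
/-- **The Peirce-`0` space vanishes when `2 · rank B > dim V^{1,0}`**: for every raising `x ∈ 𝔊`,
`x − E x − x F + E x F = 0` (`E = t⁻¹ B C`, `F = t⁻¹ C B`): this element of `𝔊` is raising with values in `(1 − E) V^{1,0}`, so of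
rank `≤ dim V^{1,0} − r < r`. [cite: MoonenZarhin1999LowDim, §2 (2.3)–(2.5)] [cite: Deligne1982HodgeCycles, I §3 (proof of Prop. 3.4, 3.6)]
[cite: GoodmanWallachGTM255, §2.1.2] -/
theorem WeightOnePeirce.peirceZero_eq_zero (H : HodgeStructure V n) (ψ : H.Polarization) (hn : n = 1)
    (heff : H.IsEffective) {Θ : Module.End ℂ (ℂ ⊗[ℚ] V)} (hΘ : ∀ p, ∀ x ∈ H.piece p (n - p), Θ x = ((2 * p - n : ℤ) : ℂ) • x)
    {𝔊 : Submodule ℂ (Module.End ℂ (ℂ ⊗[ℚ] V))} (h𝔊 : 𝔊 ≤ H.hodgeLieC) (hbr : ∀ Y ∈ 𝔊, ∀ Z ∈ 𝔊, Y * Z - Z * Y ∈ 𝔊)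
    {B C : Module.End ℂ (ℂ ⊗[ℚ] V)} (hB : B ∈ 𝔊) (hB0 : B ≠ 0) (hBP : ∀ p ∈ H.piece 1 0, B p = 0)
    (hBim : ∀ v, B v ∈ H.piece 1 0) (hC : ∀ v, C v = conj (B (conj v))) (hC𝔊 : C ∈ 𝔊)
    (hmin : ∀ B' ∈ 𝔊, B' ≠ 0 → (∀ p ∈ H.piece 1 0, B' p = 0) → (∀ v, B' v ∈ H.piece 1 0) →
      Module.finrank ℂ (LinearMap.range B) ≤ Module.finrank ℂ (LinearMap.range B'))
    {t : ℂ} (ht : t ≠ 0) (hBCB : B * C * B = t • B)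
    (h2r : Module.finrank ℂ (H.piece 1 0) < 2 * Module.finrank ℂ (LinearMap.range B))
    {x : Module.End ℂ (ℂ ⊗[ℚ] V)} (hx : x ∈ 𝔊) (hxP : ∀ p ∈ H.piece 1 0, x p = 0) (hxim : ∀ v, x v ∈ H.piece 1 0) :
    x - t⁻¹ • (B * C) * x - x * (t⁻¹ • (C * B)) + t⁻¹ • (B * C) * x * (t⁻¹ • (C * B)) = 0 := by
  classical
  obtain ⟨hCBC, -⟩ := WeightOnePeirce.conjOp_mul_conjOp_mul hC ht hB0 hBCB
  subst hn
  obtain ⟨hCQ, hCim, -, -⟩ := SymplecticThetaTen.conjOp_raise (P := H.piece 1 0) (Q := H.piece 0 1)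
    (fun x hx => conj_mem_piece H hx) (fun x hx => conj_mem_piece H hx) hBP hBim hC
  have hBB : B * B = 0 := LinearMap.ext fun v => by
    rw [Module.End.mul_apply, hBP _ (hBim v), LinearMap.zero_apply]
  have hCC : C * C = 0 := LinearMap.ext fun v => by
    rw [Module.End.mul_apply, hCQ _ (hCim v), LinearMap.zero_apply]
  obtain ⟨E, hE⟩ : ∃ E : Module.End ℂ (ℂ ⊗[ℚ] V), E = t⁻¹ • (B * C) := ⟨_, rfl⟩
  obtain ⟨F, hF⟩ : ∃ F : Module.End ℂ (ℂ ⊗[ℚ] V), F = t⁻¹ • (C * B) := ⟨_, rfl⟩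
  rw [← hE, ← hF]
  obtain ⟨-, -, hEB, -, -, -, -, -, -, -⟩ := WeightOnePeirce.tripotent_facts ht hBCB hCBC hBB hCC hE hF
  have hEP : ∀ v, E v ∈ H.piece 1 0 := fun v => by
    rw [hE, LinearMap.smul_apply, Module.End.mul_apply]
    exact Submodule.smul_mem _ _ (hBim _)
  have hFP : ∀ p ∈ H.piece 1 0, F p = 0 := fun p hp => by
    rw [hF, LinearMap.smul_apply, Module.End.mul_apply, hBP p hp, map_zero, smul_zero]
  have hxB : x * B = 0 := LinearMap.ext fun v => by
    rw [Module.End.mul_apply, hxP _ (hBim v), LinearMap.zero_apply]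
  have hBx : B * x = 0 := LinearMap.ext fun v => by
    rw [Module.End.mul_apply, hBP _ (hxim v), LinearMap.zero_apply]
  obtain ⟨hExF, hx1⟩ := WeightOnePeirce.peirceOne_mem hbr ht hBCB hCBC hBB hCC hE hF hB hC𝔊 hx hxB hBx
  have hBle : LinearMap.range B ≤ H.piece 1 0 := by
    rintro _ ⟨w, rfl⟩
    exact hBim w
  -- the Peirce-`0` component `x₀ = (1 − E) (x − x F)` is a raising element of `𝔊`
  obtain ⟨x₀, hx₀⟩ : ∃ x₀ : Module.End ℂ (ℂ ⊗[ℚ] V), x₀ = x - E * x - x * F + E * x * F := ⟨_, rfl⟩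
  rw [← hx₀]
  have hx₀𝔊 : x₀ ∈ 𝔊 := by
    have h : x₀ = x - (E * x + x * F - (2 : ℂ) • (E * x * F)) - E * x * F := by rw [hx₀, two_smul]; abel
    rw [h]
    exact Submodule.sub_mem _ (Submodule.sub_mem _ hx hx1) hExF
  have hx₀P : ∀ p ∈ H.piece 1 0, x₀ p = 0 := fun p hp => by
    simp only [hx₀, LinearMap.sub_apply, LinearMap.add_apply, Module.End.mul_apply, hFP p hp, hxP p hp, map_zero,
      add_zero, sub_zero]
  have hx₀im : ∀ v, x₀ v ∈ H.piece 1 0 := fun v => by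
    simp only [hx₀, LinearMap.sub_apply, LinearMap.add_apply, Module.End.mul_apply]
    exact Submodule.add_mem _ (Submodule.sub_mem _ (Submodule.sub_mem _ (hxim _) (hEP _)) (hxim _)) (hEP _)
  -- its values lie in `(1 − E) V^{1,0}`, of dimension `≤ dim V^{1,0} − r`
  obtain ⟨φ, hφ⟩ : ∃ φ : H.piece 1 0 →ₗ[ℂ] ℂ ⊗[ℚ] V, φ = (1 - E).domRestrict (H.piece 1 0) := ⟨_, rfl⟩
  have hkerφ : Submodule.comap (H.piece 1 0).subtype (LinearMap.range B) ≤ LinearMap.ker φ := by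
    rintro ⟨p, hp⟩ hpB
    obtain ⟨w, hw⟩ := LinearMap.mem_range.1 (Submodule.mem_comap.1 hpB)
    have hw' : B w = p := hw
    rw [LinearMap.mem_ker, hφ, LinearMap.domRestrict_apply]
    change (1 - E) p = 0
    rw [← hw', LinearMap.sub_apply, Module.End.one_apply, ← Module.End.mul_apply, hEB, sub_self]
  have hdimkerφ : Module.finrank ℂ (LinearMap.range B) ≤ Module.finrank ℂ (LinearMap.ker φ) :=
    calc Module.finrank ℂ (LinearMap.range B)
        = Module.finrank ℂ (Submodule.comap (H.piece 1 0).subtype (LinearMap.range B)) :=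
          (LinearEquiv.finrank_eq (Submodule.comapSubtypeEquivOfLe hBle)).symm
      _ ≤ Module.finrank ℂ (LinearMap.ker φ) := Submodule.finrank_mono hkerφ
  have hrnφ := LinearMap.finrank_range_add_finrank_ker φ
  have hle : LinearMap.range x₀ ≤ LinearMap.range φ := by
    rintro _ ⟨v, rfl⟩
    refine ⟨⟨x v - x (F v), Submodule.sub_mem _ (hxim _) (hxim _)⟩, ?_⟩
    rw [hφ, LinearMap.domRestrict_apply]
    change (1 - E) (x v - x (F v)) = x₀ v
    simp only [hx₀, LinearMap.sub_apply, LinearMap.add_apply, Module.End.one_apply, Module.End.mul_apply, map_sub]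
    abel
  have hdim := Submodule.finrank_mono hle
  by_contra hne
  have h := hmin x₀ hx₀𝔊 hne hx₀P hx₀im
  omega

/-- **`2 · rank B > dim V^{1,0}`: every raising `x ∈ 𝔊` is `s B + x₁`** with `x₁ = E x + x F − 2 E x F` its Peirce-`1` component
(`E = t⁻¹ B C`, `F = t⁻¹ C B`): the raising space of `𝔊` is `ℂ B ⊕ (Peirce-1 space)`. [cite: MoonenZarhin1999LowDim, §2 (2.3)–(2.5)]
[cite: Deligne1982HodgeCycles, I §3 (proof of Prop. 3.4, 3.6)] -/
theorem WeightOnePeirce.eq_smul_add_peirceOne (H : HodgeStructure V n) (ψ : H.Polarization) (hn : n = 1)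
    (heff : H.IsEffective) {Θ : Module.End ℂ (ℂ ⊗[ℚ] V)} (hΘ : ∀ p, ∀ x ∈ H.piece p (n - p), Θ x = ((2 * p - n : ℤ) : ℂ) • x)
    {𝔊 : Submodule ℂ (Module.End ℂ (ℂ ⊗[ℚ] V))} (h𝔊 : 𝔊 ≤ H.hodgeLieC) (hbr : ∀ Y ∈ 𝔊, ∀ Z ∈ 𝔊, Y * Z - Z * Y ∈ 𝔊)
    {B C : Module.End ℂ (ℂ ⊗[ℚ] V)} (hB : B ∈ 𝔊) (hB0 : B ≠ 0) (hBP : ∀ p ∈ H.piece 1 0, B p = 0)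
    (hBim : ∀ v, B v ∈ H.piece 1 0) (hC : ∀ v, C v = conj (B (conj v))) (hC𝔊 : C ∈ 𝔊)
    (hmin : ∀ B' ∈ 𝔊, B' ≠ 0 → (∀ p ∈ H.piece 1 0, B' p = 0) → (∀ v, B' v ∈ H.piece 1 0) →
      Module.finrank ℂ (LinearMap.range B) ≤ Module.finrank ℂ (LinearMap.range B'))
    {t : ℂ} (ht : t ≠ 0) (hBCB : B * C * B = t • B)
    (h2r : Module.finrank ℂ (H.piece 1 0) < 2 * Module.finrank ℂ (LinearMap.range B))
    {x : Module.End ℂ (ℂ ⊗[ℚ] V)} (hx : x ∈ 𝔊) (hxP : ∀ p ∈ H.piece 1 0, x p = 0) (hxim : ∀ v, x v ∈ H.piece 1 0) :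
    ∃ s : ℂ, x = s • B + (t⁻¹ • (B * C) * x + x * (t⁻¹ • (C * B)) - (2 : ℂ) • (t⁻¹ • (B * C) * x * (t⁻¹ • (C * B)))) := by
  obtain ⟨s, hs⟩ := WeightOnePeirce.peirceTwo_eq_smul H ψ hn heff hΘ h𝔊 hbr hB hB0 hBP hBim hC hC𝔊 hmin ht hBCB hx hxP hxim
  have h0 := WeightOnePeirce.peirceZero_eq_zero H ψ hn heff hΘ h𝔊 hbr hB hB0 hBP hBim hC hC𝔊 hmin ht hBCB h2r hx hxP hxim
  refine ⟨s, ?_⟩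
  rw [← hs]
  rw [← sub_eq_zero]
  rw [← h0]
  rw [two_smul]
  abel

end HodgeStructure

end Literature.AlgebraicGeometry.Motives
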